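import Summits.AtomisticToContinuum.HydrodynamicLimit.Theorems.CollisionIsometryCLTCollisionalTransferLocalityRhsPointwise
import HarnessLib

/-!
# Deterministic smallness of the Euler-weighted collisional pressure functional on the LLN event
(stub [Rd] `abs_integral_eulerW_pcoll_le_of_lln`, line `hemisphere-affine-slaving`, crux
`CollisionalTransferLocality`, stmt-AtomisticToContinuum-9518)

Helper file (`--supports stmt-AtomisticToContinuum-9518`; registered stub
`abs_integral_eulerW_pcoll_le_of_lln`) of the line lead, equilibrium-rung infrastructure (Rhs side,
deterministic core). Given `e > 0` there is `ε' > 0`, depending only on `(θ, σ, K, η₁, C₁, e)` and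
on a continuity modulus of `Z = hsCompressibility` at `σ³`, such that on every dilute configuration
(`ρ̄σ³ ≤ η₁`) whose block fields are `ε'`-close in `L²(𝕋³)` to `(1, 0, 3θ/2)`,
`|∫ₓ eulerW · p_c(ρ̄, θ̄)| ≤ e`, for test fields with `|div ψ|, |∇χ| ≤ C₁` and `∫ div ψ = 0`.

Proof. Since `∫ div ψ = 0`, `∫ eulerW·p_c = ∫ (eulerW·p_c − div ψ · θ (Z(σ³) − 1))` (also when the
integrand is not integrable: then both Bochner integrals vanish). The pointwise stub [Rp]
(`abs_eulerW_pcoll_sub_le_pointwise`) bounds the new integrand by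
`C₁ [(2/3) K η₁ |Ē − 3θ/2| + (K σ³/3) |m̄|² + θ |Z(ρ̄σ³) − Z(σ³)|] + 2 C₁ K σ³ |m̄| Ē`, and this is
dominated POINTWISE by an affine function `A₀ + A₁ q` of the LLN integrand
`q = (ρ̄ − 1)² + |m̄|² + (Ē − 3θ/2)²`: `|t| ≤ δ + t²/δ`, `|m̄| Ē ≤ q + (3θ/2)(δ + |m̄|²/δ)`, and —
the only analytic input — `|Z(ρ̄σ³) − Z(σ³)| ≤ e₀ + M (ρ̄ − 1)²` with `M = K(η₁ + σ³) σ⁶ / r²`,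
`r` a continuity radius of `Z` at `σ³` for `e₀` (inside the radius the difference is `< e₀`,
outside it is `≤ K(η₁ + σ³) ≤ M (ρ̄ − 1)²`: a pointwise Chebyshev alternative). Integrating over
the probability space `𝕋³` gives `A₀ + A₁ ε'`, and the constants are chosen in the order
`e₀ → r → δ → ε'` so that each of `C₁ θ e₀`, `δ·(…)`, `A₁ ε'` is `≤ e/4`. Folklore; nothing
is cited.
-/

namespace Summit.AtomisticToContinuum.HydrodynamicLimit.Theorems.HemisphereAffineSlaving

open scoped BigOperators Topology Classical ENNReal InnerProductSpace
open Filter Set Function MeasureTheory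

noncomputable section

open Literature.MathematicalPhysics.KineticTheory (T3 V3 hsCompressibility)

/-- `a · e/(4(a+1)) ≤ e/4` for `a, e ≥ 0`. [folklore] -/
theorem mul_quarter_div_le {a e : ℝ} (ha : 0 ≤ a) (he : 0 ≤ e) :
    a * (e / (4 * (a + 1))) ≤ e / 4 := by
  rw [mul_div_assoc', div_le_div_iff₀ (by positivity) (by positivity)]
  nlinarith

/-- `|t| ≤ δ + ι t²` when `δ > 0`, `δ ι = 1`. [folklore] -/
theorem abs_le_delta_add {δ ι t : ℝ} (hδ : 0 < δ) (hδι : δ * ι = 1) : |t| ≤ δ + ι * t ^ 2 := by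
  have h1 : δ * ι * t ^ 2 = t ^ 2 := by rw [hδι, one_mul]
  have key : 0 ≤ δ * (δ + ι * t ^ 2 - |t|) := by
    nlinarith [sq_nonneg (|t| - δ), sq_abs t, abs_nonneg t]
  have := (mul_nonneg_iff_of_pos_left hδ).1 key
  linarith

/-- Scalar core of [Rd]: the pointwise bound of [Rp] is dominated by an affine function of the
LLN integrand `q = d² + n² + t²` (`t = E − 3θ/2`, `n = |m̄|`, `d = ρ̄ − 1`), given
`|dZ| ≤ e₀ + M d²`. [folklore] -/
theorem rd_core_le {C₁ K η₁ σ3 θ δ ι e₀ M t n d dZ E : ℝ} (hC₁ : 0 ≤ C₁) (hK : 0 ≤ K)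
    (hη₁ : 0 ≤ η₁) (hσ3 : 0 ≤ σ3) (hθ : 0 ≤ θ) (hδ : 0 < δ) (hδι : δ * ι = 1) (hM : 0 ≤ M)
    (hn : 0 ≤ n) (hE : E = t + 3 / 2 * θ) (hdZ : |dZ| ≤ e₀ + M * d ^ 2) :
    C₁ * (2 / 3 * K * η₁ * |t| + K * σ3 / 3 * n ^ 2 + θ * |dZ|) + 2 * C₁ * K * σ3 * (n * E) ≤
      (δ * (2 / 3 * C₁ * K * η₁ + 3 * C₁ * K * σ3 * θ) + C₁ * θ * e₀) +
        (C₁ * (2 / 3 * K * η₁ * ι + K * σ3 / 3 + θ * M) + 2 * C₁ * K * σ3 * (1 + 3 / 2 * θ * ι)) *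
          (d ^ 2 + n ^ 2 + t ^ 2) := by
  have hι : 0 ≤ ι := by nlinarith
  have ht : |t| ≤ δ + ι * (d ^ 2 + n ^ 2 + t ^ 2) := by
    have h := abs_le_delta_add (t := t) hδ hδι
    nlinarith [sq_nonneg d, sq_nonneg n]
  have hn' : n ≤ δ + ι * (d ^ 2 + n ^ 2 + t ^ 2) := by
    have h := abs_le_delta_add (t := n) hδ hδι
    rw [abs_of_nonneg hn] at h
    nlinarith [sq_nonneg d, sq_nonneg t]
  have hn2 : n ^ 2 ≤ d ^ 2 + n ^ 2 + t ^ 2 := by nlinarith [sq_nonneg d, sq_nonneg t]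
  have hnt : n * |t| ≤ d ^ 2 + n ^ 2 + t ^ 2 := by
    nlinarith [sq_nonneg (n - |t|), sq_abs t, sq_nonneg d]
  have hdZ' : |dZ| ≤ e₀ + M * (d ^ 2 + n ^ 2 + t ^ 2) := by
    nlinarith [mul_le_mul_of_nonneg_left (by nlinarith [sq_nonneg n, sq_nonneg t] :
      d ^ 2 ≤ d ^ 2 + n ^ 2 + t ^ 2) hM]
  have hnE : n * E ≤ (d ^ 2 + n ^ 2 + t ^ 2) + 3 / 2 * θ * (δ + ι * (d ^ 2 + n ^ 2 + t ^ 2)) := by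
    rw [hE]
    have h1 : n * t ≤ n * |t| := mul_le_mul_of_nonneg_left (le_abs_self t) hn
    nlinarith [mul_le_mul_of_nonneg_left hn' (by positivity : (0 : ℝ) ≤ 3 / 2 * θ)]
  have c1 := mul_le_mul_of_nonneg_left ht (by positivity : (0 : ℝ) ≤ C₁ * (2 / 3 * K * η₁))
  have c2 := mul_le_mul_of_nonneg_left hn2 (by positivity : (0 : ℝ) ≤ C₁ * (K * σ3 / 3))
  have c3 := mul_le_mul_of_nonneg_left hdZ' (by positivity : (0 : ℝ) ≤ C₁ * θ)
  have c4 := mul_le_mul_of_nonneg_left hnE (by positivity : (0 : ℝ) ≤ 2 * C₁ * K * σ3)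
  nlinarith [c1, c2, c3, c4]

/-- The pointwise Chebyshev alternative for the compressibility factor: given the linear window
`|Z(η) − 1| ≤ K η` on `[0, η_Z] ∋ η₁, σ³` and continuity of `Z` at `σ³`, for every `e₀ > 0` there
is `M ≥ 0` with `|Z(ρσ³) − Z(σ³)| ≤ e₀ + M (ρ − 1)²` for all `0 ≤ ρ`, `ρσ³ ≤ η₁`. [folklore] -/
theorem exists_abs_hsCompressibility_sub_le {σ K ηZ η₁ : ℝ} (hσ : 0 < σ) (hK : 0 ≤ K)
    (hη₁ : 0 < η₁) (hη₁Z : η₁ ≤ ηZ) (hσZ : σ ^ 3 ≤ ηZ)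
    (hZ : ∀ η : ℝ, 0 ≤ η → η ≤ ηZ → |hsCompressibility η - 1| ≤ K * η)
    (hZc : ContinuousAt hsCompressibility (σ ^ 3)) {e₀ : ℝ} (he₀ : 0 < e₀) :
    ∃ M : ℝ, 0 ≤ M ∧ ∀ ρ : ℝ, 0 ≤ ρ → ρ * σ ^ 3 ≤ η₁ →
      |hsCompressibility (ρ * σ ^ 3) - hsCompressibility (σ ^ 3)| ≤ e₀ + M * (ρ - 1) ^ 2 := by
  have hσ3 : 0 < σ ^ 3 := pow_pos hσ 3
  obtain ⟨r, hr, hrZ⟩ := Metric.continuousAt_iff.1 hZc e₀ he₀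
  refine ⟨K * (η₁ + σ ^ 3) * (σ ^ 3) ^ 2 / r ^ 2, by positivity, fun ρ hρ hρd => ?_⟩
  · by_cases h : |ρ * σ ^ 3 - σ ^ 3| < r
    · have h1 : |hsCompressibility (ρ * σ ^ 3) - hsCompressibility (σ ^ 3)| < e₀ := by
        have := hrZ (by rwa [Real.dist_eq])
        rwa [Real.dist_eq] at this
      have h2 : 0 ≤ K * (η₁ + σ ^ 3) * (σ ^ 3) ^ 2 / r ^ 2 * (ρ - 1) ^ 2 := by positivity
      linarith
    · replace h := not_lt.1 h
      have h1 : |hsCompressibility (ρ * σ ^ 3) - hsCompressibility (σ ^ 3)| ≤ K * (η₁ + σ ^ 3) := by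
        calc |hsCompressibility (ρ * σ ^ 3) - hsCompressibility (σ ^ 3)|
            = |(hsCompressibility (ρ * σ ^ 3) - 1) - (hsCompressibility (σ ^ 3) - 1)| := by ring_nf
          _ ≤ |hsCompressibility (ρ * σ ^ 3) - 1| + |hsCompressibility (σ ^ 3) - 1| := abs_sub _ _
          _ ≤ K * (ρ * σ ^ 3) + K * σ ^ 3 :=
              add_le_add (hZ _ (by positivity) (hρd.trans hη₁Z)) (hZ _ hσ3.le hσZ)
          _ ≤ K * η₁ + K * σ ^ 3 := by gcongr
          _ = K * (η₁ + σ ^ 3) := by ring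
      have h2 : r ^ 2 ≤ (σ ^ 3) ^ 2 * (ρ - 1) ^ 2 := by
        calc r ^ 2 ≤ |ρ * σ ^ 3 - σ ^ 3| ^ 2 := pow_le_pow_left₀ hr.le h 2
          _ = (σ ^ 3) ^ 2 * (ρ - 1) ^ 2 := by rw [sq_abs]; ring
      have h3 : 1 ≤ (σ ^ 3) ^ 2 * (ρ - 1) ^ 2 / r ^ 2 := by
        rw [le_div_iff₀ (by positivity)]; linarith
      calc |hsCompressibility (ρ * σ ^ 3) - hsCompressibility (σ ^ 3)|
          ≤ K * (η₁ + σ ^ 3) * 1 := by rw [mul_one]; exact h1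
        _ ≤ K * (η₁ + σ ^ 3) * ((σ ^ 3) ^ 2 * (ρ - 1) ^ 2 / r ^ 2) :=
            mul_le_mul_of_nonneg_left h3 (by positivity)
        _ = K * (η₁ + σ ^ 3) * (σ ^ 3) ^ 2 / r ^ 2 * (ρ - 1) ^ 2 := by
            field_simp
        _ ≤ e₀ + K * (η₁ + σ ^ 3) * (σ ^ 3) ^ 2 / r ^ 2 * (ρ - 1) ^ 2 := le_add_of_nonneg_left he₀.le

/-- **[Rd] Registered stub `abs_integral_eulerW_pcoll_le_of_lln`** of crux
stmt-AtomisticToContinuum-9518 (line hemisphere-affine-slaving, equilibrium rung, Rhs side):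
deterministic smallness of `∫ₓ eulerW · p_c(ρ̄, θ̄)` on dilute configurations whose block fields
are `ε'`-close in `L²(𝕋³)` to `(1, 0, 3θ/2)`, for test fields with `|div ψ|, |∇χ| ≤ C₁`,
`∫ div ψ = 0`. Centre by `div ψ · θ (Z(σ³) − 1)` (integral zero), bound pointwise by [Rp] and
then by the affine function `A₀ + A₁ q` of the LLN integrand (`rd_core_le`, with the pointwise
Chebyshev alternative `exists_abs_hsCompressibility_sub_le` for the compressibility factor),
integrate over the probability space `𝕋³`, and choose `e₀ → δ → ε'` so that
`A₀ + A₁ ε' ≤ 3e/4`. [folklore] -/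
theorem abs_integral_eulerW_pcoll_le_of_lln : ∀ (θ σ K ηZ η₁ C₁ : ℝ), 0 < θ → 0 < σ → 0 ≤ K → 0 < η₁ → η₁ ≤ ηZ → σ ^ 3 ≤ ηZ → 0 ≤ C₁ → (∀ η : ℝ, 0 ≤ η → η ≤ ηZ → |Literature.MathematicalPhysics.KineticTheory.hsCompressibility η - 1| ≤ K * η) → ContinuousAt Literature.MathematicalPhysics.KineticTheory.hsCompressibility (σ ^ 3) → ∀ e : ℝ, 0 < e → ∃ ε' : ℝ, 0 < ε' ∧ ∀ (φ : ℕ → T3 → ℝ) (N : ℕ), Continuous (φ N) → (∀ y, 0 ≤ φ N y) → ∀ (ψ : ℝ → T3 → V3) (χ : ℝ → T3 → ℝ) (s : ℝ), Continuous (fun y => divPsi ψ s y) → (∀ y, |divPsi ψ s y| ≤ C₁) → (∀ y a, |gradChi χ s y a| ≤ C₁) → ∫ y, divPsi ψ s y = 0 → ∀ w : Cfg N, (∀ x, rhoB φ N w x * σ ^ 3 ≤ η₁) → ∫ x, ((rhoB φ N w x - 1) ^ 2 + ‖mB φ N w x‖ ^ 2 + (EB φ N w x - 3 / 2 * θ)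 ^ 2) ≤ ε' → |∫ x, eulerW ψ χ φ N s w x * pcoll σ (rhoB φ N w x) (thetaB φ N w x)| ≤ e := by
  intro θ σ K ηZ η₁ C₁ hθ hσ hK hη₁ hη₁Z hσZ hC₁ hZ hZc e he
  have hσ3 : 0 < σ ^ 3 := pow_pos hσ 3
  -- the constants, in the order `e₀ → (r, M) → δ → A₁ → ε'`
  obtain ⟨e₀, he₀, he₀b⟩ : ∃ e₀ : ℝ, 0 < e₀ ∧ C₁ * θ * e₀ ≤ e / 4 :=
    ⟨e / (4 * (C₁ * θ + 1)), by positivity, mul_quarter_div_le (by positivity) he.le⟩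
  obtain ⟨M, hM0, hM⟩ :=
    exists_abs_hsCompressibility_sub_le (η₁ := η₁) hσ hK hη₁ hη₁Z hσZ hZ hZc he₀
  obtain ⟨δ, hδ, hδb⟩ : ∃ δ : ℝ, 0 < δ ∧
      δ * (2 / 3 * C₁ * K * η₁ + 3 * C₁ * K * σ ^ 3 * θ) ≤ e / 4 :=
    ⟨e / (4 * (2 / 3 * C₁ * K * η₁ + 3 * C₁ * K * σ ^ 3 * θ + 1)), by positivity, by
      rw [mul_comm]; exact mul_quarter_div_le (by positivity) he.le⟩
  obtain ⟨A₁, hA₁0, hA₁⟩ : ∃ A₁ : ℝ, 0 ≤ A₁ ∧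
      A₁ = C₁ * (2 / 3 * K * η₁ * δ⁻¹ + K * σ ^ 3 / 3 + θ * M) +
        2 * C₁ * K * σ ^ 3 * (1 + 3 / 2 * θ * δ⁻¹) :=
    ⟨_, by positivity, rfl⟩
  refine ⟨e / (4 * (A₁ + 1)), by positivity, ?_⟩
  intro φ N hφc hφ0 ψ χ s hDc hD hG hD0 w hdil hL2
  -- pointwise domination of the centred integrand by `A₀ + A₁ q`
  have hpt : ∀ x, ‖eulerW ψ χ φ N s w x * pcoll σ (rhoB φ N w x) (thetaB φ N w x) -
      divPsi ψ s x * (θ * (hsCompressibility (σ ^ 3) - 1))‖ ≤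
      (δ * (2 / 3 * C₁ * K * η₁ + 3 * C₁ * K * σ ^ 3 * θ) + C₁ * θ * e₀) +
        A₁ * ((rhoB φ N w x - 1) ^ 2 + ‖mB φ N w x‖ ^ 2 + (EB φ N w x - 3 / 2 * θ) ^ 2) := by
    intro x
    rw [Real.norm_eq_abs, hA₁]
    exact (abs_eulerW_pcoll_sub_le_pointwise θ σ K ηZ η₁ C₁ hθ hσ hK hη₁ hη₁Z hσZ hC₁ hZ φ N hφ0
      ψ χ s hD hG w x (hdil x)).trans (rd_core_le hC₁ hK hη₁.le hσ3.le hθ.le hδ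
        (mul_inv_cancel₀ hδ.ne') hM0 (norm_nonneg (mB φ N w x))
        (by ring : EB φ N w x = EB φ N w x - 3 / 2 * θ + 3 / 2 * θ)
        (hM (rhoB φ N w x) (rhoB_nonneg hφ0) (hdil x)))
  -- integrability of the dominating function and of the centring term
  have hq : Continuous fun x =>
      (rhoB φ N w x - 1) ^ 2 + ‖mB φ N w x‖ ^ 2 + (EB φ N w x - 3 / 2 * θ) ^ 2 := by
    simp only [rhoB_eq, mB_eq, EB_eq]
    fun_prop
  have hqi := hq.integrable_unitAddTorus
  have hG' : Integrable (fun x => divPsi ψ s x * (θ * (hsCompressibility (σ ^ 3) - 1))) :=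
    hDc.integrable_unitAddTorus.mul_const _
  have hG0 : ∫ x, divPsi ψ s x * (θ * (hsCompressibility (σ ^ 3) - 1)) = 0 := by
    rw [integral_mul_const, hD0, zero_mul]
  by_cases hF : Integrable (fun x => eulerW ψ χ φ N s w x * pcoll σ (rhoB φ N w x) (thetaB φ N w x))
  swap
  · rw [integral_undef hF, abs_zero]
    exact he.le
  have key : ∫ x, eulerW ψ χ φ N s w x * pcoll σ (rhoB φ N w x) (thetaB φ N w x) =
      ∫ x, (eulerW ψ χ φ N s w x * pcoll σ (rhoB φ N w x) (thetaB φ N w x) -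
        divPsi ψ s x * (θ * (hsCompressibility (σ ^ 3) - 1))) := by
    rw [integral_sub hF hG', hG0, sub_zero]
  rw [key]
  calc |∫ x, (eulerW ψ χ φ N s w x * pcoll σ (rhoB φ N w x) (thetaB φ N w x) -
        divPsi ψ s x * (θ * (hsCompressibility (σ ^ 3) - 1)))|
      = ‖∫ x, (eulerW ψ χ φ N s w x * pcoll σ (rhoB φ N w x) (thetaB φ N w x) -
        divPsi ψ s x * (θ * (hsCompressibility (σ ^ 3) - 1)))‖ := (Real.norm_eq_abs _).symm
    _ ≤ ∫ x, ((δ * (2 / 3 * C₁ * K * η₁ + 3 * C₁ * K * σ ^ 3 * θ) + C₁ * θ * e₀) +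
        A₁ * ((rhoB φ N w x - 1) ^ 2 + ‖mB φ N w x‖ ^ 2 + (EB φ N w x - 3 / 2 * θ) ^ 2)) :=
        norm_integral_le_of_norm_le ((integrable_const _).add (hqi.const_mul A₁)) (ae_of_all _ hpt)
    _ = (δ * (2 / 3 * C₁ * K * η₁ + 3 * C₁ * K * σ ^ 3 * θ) + C₁ * θ * e₀) +
        A₁ * ∫ x, ((rhoB φ N w x - 1) ^ 2 + ‖mB φ N w x‖ ^ 2 + (EB φ N w x - 3 / 2 * θ) ^ 2) := by
        rw [integral_add (integrable_const _) (hqi.const_mul A₁), integral_const, integral_const_mul,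
          probReal_univ, one_smul]
    _ ≤ (δ * (2 / 3 * C₁ * K * η₁ + 3 * C₁ * K * σ ^ 3 * θ) + C₁ * θ * e₀) +
        A₁ * (e / (4 * (A₁ + 1))) := by gcongr
    _ ≤ e := by linarith [mul_quarter_div_le hA₁0 he.le]

end

end Summit.AtomisticToContinuum.HydrodynamicLimit.Theorems.HemisphereAffineSlaving
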